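import Mathlib
import HarnessLib
import Summits.ValiantsHypothesis.ValiantsHypothesis.Theorems.LacunarySymmetroidMatrixDescartesProductPlusOneRiccati

/-!
# ValiantsHypothesis / LacunarySymmetroid — crux `MatrixDescartes` (stmt-ValiantsHypothesis-18050, V1),
# LINE (A) «product_plus_one», floor at the MIDDLE coupling: the AB-reduction for NO-DIP company (letter-partial sums, type-β windows)

Middle-coupling twin of ✓/⧗ `…ProductPlusOneABWindow` (val-idea-25 g3's AB-reduction, bottom coupling).  Setting: K = 3, support
`(d₀, d₀+p, d₀+p+s)` (`0 < p`, `0 < s`), MIDDLE coupling `l₀ = 1`, rows `f_j = a_{j0} x^{d₀} + a_{j1} x^{d₀+p} + a_{j2} x^{d₀+p+s}`, reduced rows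
`g_j = a_{j0} + a_{j1} x^p + a_{j2} x^{p+s}`, NO-DIP company `a_{j0}·a_{j2} ≤ 0` (middle coefficients FREE) — desk #355 (B) sector («middle
coupling beyond ✓ `…MiddleLaurent`»), where no per-factor chart exists (p5 g13 obstruction note; p5 g14 memo: collective up-crossings, 7 zeros
on one component certified).  The middle Euler letter is `X f′ − (d₀+p) f = −p a₀ x^{d₀} + s a₂ x^{d₀+p+s}`, so off the poles

* (M0) `eulerRatioMiddle_eq_letterTerms`, `eulerNumeratorMiddle_eval_eq_zero_iff` — `Σ_j Φ_j(x) = x^{−p}·(−p·A₀(x) + s·x^{p+s}·A₂(x))`,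
  so off the poles `R(x) = 0 ⟺ −p A₀ + s x^{p+s} A₂ = 0`, with the (Laurent-normalised) LETTER-PARTIAL SUMS `A₀ = Σ_j a_{j0} x^p/g_j`, `A₂ = Σ_j a_{j2} x^p/g_j`;
* (M1) `hasDerivAt_letterTermMiddle`, `letterSumsMiddle_monotone` — for no-dip rows `A₀` is ISOTONE and `A₂` ANTITONE on every pole-free interval
  `[u,v] ⊂ (0,∞)` (`(a₀x^p/g)′ = x^{p−1}(p a₀² − s a₀a₂ x^{p+s})/g² ≥ 0`, `(a₂x^p/g)′ = x^{p−1}(p a₀a₂ − s a₂² x^{p+s})/g² ≤ 0`; no ratio condition,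
  `a_{j1}` free);
* (M3) ★ `eulerNumeratorMiddle_roots_Icc_le_one_of_letterSumTwo_neg` / `…_of_letterSumZero_neg` — if `A₂ < 0` on the pole-free interval, or
  `A₀ < 0` on it, the c-free Euler numerator `eulerNumerator d a 1` has AT MOST ONE zero there (`−pA₀ + s x^{p+s}A₂`, resp.
  `−p x^{−(p+s)}A₀ + sA₂`, strictly antitone).  The first component `(0, z_min)` (`A₀ > 0 > A₂`) and the last one (`A₀ < 0 < A₂`) are of this
  kind; every extra zero of the middle floor sits in a window where `A₀ > 0` and `A₂ > 0` somewhere (the middle «type α»).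

HONEST FRAMING: located helper lemmas; the count in type-α windows is the research piece (budget-shaped, cf. ✓ `…CrossingBudget`); NOT
`stub_classRowK3`, not `OneChangeFloorK3`, not `stub_polyLaw`, not `MatrixDescartes`, not Conjecture B; `VP ≠ VNP` is NOT proved.  No definitions,
no named facts.
-/

set_option linter.dupNamespace false

namespace Summit.ValiantsHypothesis.ValiantsHypothesis.Theorems.LacunarySymmetroidMatrixDescartes

namespace ProductPlusOne

open Polynomial Finset
open scoped BigOperators

/-! ### M0 — the middle Euler sum through the letter-partial sums -/

/-- The row and its MIDDLE Euler letter in the `(d₀, d₀+p, d₀+p+s)` form. [folklore] -/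
theorem eval_trinomial_three_middle (d0 p s : ℕ) (b : Fin 3 → ℝ) (x : ℝ) :
    (∑ l, C (b l) * X ^ ((![d0, d0 + p, d0 + p + s] : Fin 3 → ℕ) l) : ℝ[X]).eval x
      = b 0 * x ^ d0 + b 1 * x ^ (d0 + p) + b 2 * x ^ (d0 + p + s) ∧
    (X * derivative (∑ l, C (b l) * X ^ ((![d0, d0 + p, d0 + p + s] : Fin 3 → ℕ) l) : ℝ[X])
        - C ((((![d0, d0 + p, d0 + p + s] : Fin 3 → ℕ) 1 : ℕ) : ℝ)) *
          ∑ l, C (b l) * X ^ ((![d0, d0 + p, d0 + p + s] : Fin 3 → ℕ) l)).eval x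
      = -(p : ℝ) * b 0 * x ^ d0 + (s : ℝ) * b 2 * x ^ (d0 + p + s) := by
  constructor
  · simp [Fin.sum_univ_three]
  · rw [euler_fewnomial]
    simp [Fin.sum_univ_three]
    ring

/-- One row at the middle coupling: `x^p·Φ = −p·(a₀x^p/g) + s x^{p+s}·(a₂x^p/g)` for `x > 0`, `g = a₀ + a₁x^p + a₂x^{p+s}` (also at a pole,
by the `x/0 = 0` convention). [folklore] -/
theorem eulerRatioMiddle_eq_letterTerms (a₀ a₁ a₂ : ℝ) (d0 p s : ℕ) {x : ℝ} (hx : 0 < x) :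
    x ^ p * ((-(p : ℝ) * a₀ * x ^ d0 + (s : ℝ) * a₂ * x ^ (d0 + p + s)) / (a₀ * x ^ d0 + a₁ * x ^ (d0 + p) + a₂ * x ^ (d0 + p + s)))
      = -(p : ℝ) * (a₀ * x ^ p / (a₀ + a₁ * x ^ p + a₂ * x ^ (p + s)))
        + (s : ℝ) * x ^ (p + s) * (a₂ * x ^ p / (a₀ + a₁ * x ^ p + a₂ * x ^ (p + s))) := by
  have hx0 : x ^ d0 ≠ 0 := pow_ne_zero _ hx.ne'
  have hF : a₀ * x ^ d0 + a₁ * x ^ (d0 + p) + a₂ * x ^ (d0 + p + s) = x ^ d0 * (a₀ + a₁ * x ^ p + a₂ * x ^ (p + s)) := by ring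
  rw [hF]
  field_simp
  ring

/-! ### M1 — monotonicity of the letter-partial sums for no-dip rows -/

/-- Derivative of `c·x^p/(a₀ + a₁x^p + a₂x^{p+s})`:  `c·x^{p−1}·(p a₀ − s a₂ x^{p+s})/g²` (for `p ≥ 1`). [folklore] -/
theorem hasDerivAt_letterTermMiddle (a₀ a₁ a₂ c : ℝ) (p s : ℕ) (hp : 0 < p) {x : ℝ} (hg : a₀ + a₁ * x ^ p + a₂ * x ^ (p + s) ≠ 0) :
    HasDerivAt (fun y => c * y ^ p / (a₀ + a₁ * y ^ p + a₂ * y ^ (p + s)))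
      (c * x ^ (p - 1) * ((p : ℝ) * a₀ - (s : ℝ) * a₂ * x ^ (p + s)) / (a₀ + a₁ * x ^ p + a₂ * x ^ (p + s)) ^ 2) x := by
  have hg' : HasDerivAt (fun y => a₀ + a₁ * y ^ p + a₂ * y ^ (p + s))
      (a₁ * ((p : ℝ) * x ^ (p - 1)) + a₂ * (((p + s : ℕ) : ℝ) * x ^ (p + s - 1))) x := by
    have h1 := ((hasDerivAt_pow p x).const_mul a₁).const_add a₀
    have h2 := (hasDerivAt_pow (p + s) x).const_mul a₂
    exact h1.add h2
  have hnum : HasDerivAt (fun y => c * y ^ p) (c * ((p : ℝ) * x ^ (p - 1))) x := (hasDerivAt_pow p x).const_mul c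
  have h := hnum.div hg' hg
  refine h.congr_deriv ?_
  obtain ⟨p', rfl⟩ : ∃ p', p = p' + 1 := ⟨p - 1, by omega⟩
  simp only [Nat.add_sub_cancel, Nat.cast_add, Nat.cast_one]
  have e1 : x ^ (p' + 1) = x ^ p' * x := pow_succ x p'
  have e2 : x ^ (p' + 1 + s - 1) = x ^ p' * x ^ s := by
    rw [show p' + 1 + s - 1 = p' + s by omega, pow_add]
  have e3 : x ^ (p' + 1 + s) = x ^ p' * x * x ^ s := by rw [pow_add, pow_succ]
  rw [e1, e2, e3]
  field_simp
  ring

/-- **(M1)** For NO-DIP rows (`a_{j0} a_{j2} ≤ 0`, `p ≥ 1`): on a pole-free interval `[u,v] ⊂ (0,∞)` the bottom-letter partial sum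
`A₀ = Σ_j a_{j0}x^p/g_j` is ISOTONE and the top-letter partial sum `A₂ = Σ_j a_{j2}x^p/g_j` is ANTITONE. [folklore; AB1's middle twin] -/
theorem letterSumsMiddle_monotone {m : ℕ} (p s : ℕ) (hp : 0 < p) (a : Fin m → Fin 3 → ℝ) (hnd : ∀ j, a j 0 * a j 2 ≤ 0) {u v : ℝ}
    (hu : 0 < u) (hg : ∀ x ∈ Set.Icc u v, ∀ j, a j 0 + a j 1 * x ^ p + a j 2 * x ^ (p + s) ≠ 0) :
    MonotoneOn (fun y => ∑ j, a j 0 * y ^ p / (a j 0 + a j 1 * y ^ p + a j 2 * y ^ (p + s))) (Set.Icc u v) ∧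
    AntitoneOn (fun y => ∑ j, a j 2 * y ^ p / (a j 0 + a j 1 * y ^ p + a j 2 * y ^ (p + s))) (Set.Icc u v) := by
  have hx0 : ∀ x ∈ Set.Icc u v, 0 < x := fun x hx => hu.trans_le hx.1
  have hder : ∀ c : ℝ, ∀ j, ∀ x ∈ Set.Icc u v, HasDerivAt (fun y => c * y ^ p / (a j 0 + a j 1 * y ^ p + a j 2 * y ^ (p + s)))
      (c * x ^ (p - 1) * ((p : ℝ) * a j 0 - (s : ℝ) * a j 2 * x ^ (p + s)) / (a j 0 + a j 1 * x ^ p + a j 2 * x ^ (p + s)) ^ 2) x :=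
    fun c j x hx => hasDerivAt_letterTermMiddle (a j 0) (a j 1) (a j 2) c p s hp (hg x hx j)
  -- per-row monotonicity from the sign of the derivative
  have hmono : ∀ j, MonotoneOn (fun y => a j 0 * y ^ p / (a j 0 + a j 1 * y ^ p + a j 2 * y ^ (p + s))) (Set.Icc u v) := by
    intro j
    refine monotoneOn_of_deriv_nonneg (convex_Icc u v) ?_ ?_ ?_
    · exact fun x hx => (hder (a j 0) j x hx).continuousAt.continuousWithinAt
    · rw [interior_Icc]
      exact fun x hx => (hder (a j 0) j x (Set.Ioo_subset_Icc_self hx)).differentiableAt.differentiableWithinAt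
    · rw [interior_Icc]
      intro x hx
      have hxI := Set.Ioo_subset_Icc_self hx
      rw [(hder (a j 0) j x hxI).deriv]
      refine div_nonneg ?_ (sq_nonneg _)
      have hxp : 0 ≤ x ^ (p - 1) := pow_nonneg (hx0 x hxI).le _
      have : a j 0 * x ^ (p - 1) * ((p : ℝ) * a j 0 - (s : ℝ) * a j 2 * x ^ (p + s))
          = x ^ (p - 1) * ((p : ℝ) * (a j 0 * a j 0) - (s : ℝ) * (a j 0 * a j 2) * x ^ (p + s)) := by ring
      rw [this]
      refine mul_nonneg hxp ?_
      have h1 : 0 ≤ (p : ℝ) * (a j 0 * a j 0) := mul_nonneg (Nat.cast_nonneg _) (mul_self_nonneg _)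
      have h2 : (s : ℝ) * (a j 0 * a j 2) * x ^ (p + s) ≤ 0 :=
        mul_nonpos_of_nonpos_of_nonneg (mul_nonpos_of_nonneg_of_nonpos (Nat.cast_nonneg _) (hnd j)) (pow_nonneg (hx0 x hxI).le _)
      linarith
  have hanti : ∀ j, AntitoneOn (fun y => a j 2 * y ^ p / (a j 0 + a j 1 * y ^ p + a j 2 * y ^ (p + s))) (Set.Icc u v) := by
    intro j
    refine antitoneOn_of_deriv_nonpos (convex_Icc u v) ?_ ?_ ?_
    · exact fun x hx => (hder (a j 2) j x hx).continuousAt.continuousWithinAt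
    · rw [interior_Icc]
      exact fun x hx => (hder (a j 2) j x (Set.Ioo_subset_Icc_self hx)).differentiableAt.differentiableWithinAt
    · rw [interior_Icc]
      intro x hx
      have hxI := Set.Ioo_subset_Icc_self hx
      rw [(hder (a j 2) j x hxI).deriv]
      refine div_nonpos_of_nonpos_of_nonneg ?_ (sq_nonneg _)
      have hxp : 0 ≤ x ^ (p - 1) := pow_nonneg (hx0 x hxI).le _
      have : a j 2 * x ^ (p - 1) * ((p : ℝ) * a j 0 - (s : ℝ) * a j 2 * x ^ (p + s))
          = x ^ (p - 1) * ((p : ℝ) * (a j 0 * a j 2) - (s : ℝ) * (a j 2 * a j 2) * x ^ (p + s)) := by ring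
      rw [this]
      refine mul_nonpos_of_nonneg_of_nonpos hxp ?_
      have h1 : (p : ℝ) * (a j 0 * a j 2) ≤ 0 := mul_nonpos_of_nonneg_of_nonpos (Nat.cast_nonneg _) (hnd j)
      have h2 : 0 ≤ (s : ℝ) * (a j 2 * a j 2) * x ^ (p + s) :=
        mul_nonneg (mul_nonneg (Nat.cast_nonneg _) (mul_self_nonneg _)) (pow_nonneg (hx0 x hxI).le _)
      linarith
  constructor
  · intro x hx y hy hxy
    exact Finset.sum_le_sum fun j _ => hmono j hx hy hxy
  · intro x hx y hy hxy
    exact Finset.sum_le_sum fun j _ => hanti j hx hy hxy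

/-! ### M3 — at most one zero on type-β windows of the middle coupling -/

/-- The middle Euler numerator vanishes at `x > 0` off the poles iff `−p A₀(x) + s x^{p+s} A₂(x) = 0`. [folklore] -/
theorem eulerNumeratorMiddle_eval_eq_zero_iff {m : ℕ} (d0 p s : ℕ) (a : Fin m → Fin 3 → ℝ) {x : ℝ} (hx : 0 < x)
    (hg : ∀ j, a j 0 + a j 1 * x ^ p + a j 2 * x ^ (p + s) ≠ 0) :
    (∑ j, (∑ l, C (a j l * (((![d0, d0 + p, d0 + p + s] : Fin 3 → ℕ) l : ℝ) - (![d0, d0 + p, d0 + p + s] : Fin 3 → ℕ) 1)) *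
        X ^ ((![d0, d0 + p, d0 + p + s] : Fin 3 → ℕ) l)) *
      ∏ i ∈ Finset.univ.erase j, (∑ l, C (a i l) * X ^ ((![d0, d0 + p, d0 + p + s] : Fin 3 → ℕ) l)) : ℝ[X]).eval x = 0 ↔
    -(p : ℝ) * (∑ j, a j 0 * x ^ p / (a j 0 + a j 1 * x ^ p + a j 2 * x ^ (p + s)))
        + (s : ℝ) * x ^ (p + s) * (∑ j, a j 2 * x ^ p / (a j 0 + a j 1 * x ^ p + a j 2 * x ^ (p + s))) = 0 := by
  classical
  set d : Fin 3 → ℕ := ![d0, d0 + p, d0 + p + s] with hd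
  have hev := fun j => eval_trinomial_three_middle d0 p s (a j) x
  have hxd : x ^ d0 ≠ 0 := pow_ne_zero _ hx.ne'
  have hxp : x ^ p ≠ 0 := pow_ne_zero _ hx.ne'
  have hF : ∀ j, a j 0 * x ^ d0 + a j 1 * x ^ (d0 + p) + a j 2 * x ^ (d0 + p + s)
      = x ^ d0 * (a j 0 + a j 1 * x ^ p + a j 2 * x ^ (p + s)) := fun j => by ring
  have hf : ∀ j, (∑ l, C (a j l) * X ^ (d l) : ℝ[X]).eval x ≠ 0 := by
    intro j h
    rw [(hev j).1, hF j] at h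
    exact (mul_ne_zero hxd (hg j)) h
  rw [eval_eulerNumerator_eq_prod_mul_sum d a 1 hf]
  have hP : (∏ j, (∑ l, C (a j l) * X ^ (d l) : ℝ[X]).eval x) ≠ 0 := Finset.prod_ne_zero_iff.2 fun j _ => hf j
  rw [mul_eq_zero, or_iff_right hP]
  have hsum : (∑ j, (X * derivative (∑ l, C (a j l) * X ^ (d l) : ℝ[X]) - C ((d 1 : ℕ) : ℝ) * ∑ l, C (a j l) * X ^ (d l)).eval x
        / (∑ l, C (a j l) * X ^ (d l) : ℝ[X]).eval x)
      = ∑ j, (-(p : ℝ) * a j 0 * x ^ d0 + (s : ℝ) * a j 2 * x ^ (d0 + p + s))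
          / (a j 0 * x ^ d0 + a j 1 * x ^ (d0 + p) + a j 2 * x ^ (d0 + p + s)) := by
    refine Finset.sum_congr rfl fun j _ => ?_
    rw [(hev j).1, (hev j).2]
  rw [hsum]
  -- multiply by `x^p ≠ 0`
  have key : x ^ p * ∑ j, (-(p : ℝ) * a j 0 * x ^ d0 + (s : ℝ) * a j 2 * x ^ (d0 + p + s))
          / (a j 0 * x ^ d0 + a j 1 * x ^ (d0 + p) + a j 2 * x ^ (d0 + p + s))
      = -(p : ℝ) * (∑ j, a j 0 * x ^ p / (a j 0 + a j 1 * x ^ p + a j 2 * x ^ (p + s)))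
        + (s : ℝ) * x ^ (p + s) * (∑ j, a j 2 * x ^ p / (a j 0 + a j 1 * x ^ p + a j 2 * x ^ (p + s))) := by
    rw [Finset.mul_sum, Finset.mul_sum, Finset.mul_sum, ← Finset.sum_add_distrib]
    exact Finset.sum_congr rfl fun j _ => eulerRatioMiddle_eq_letterTerms (a j 0) (a j 1) (a j 2) d0 p s hx
  rw [← key]
  constructor
  · intro h; rw [h, mul_zero]
  · intro h; exact (mul_eq_zero.mp h).resolve_left hxp

/-- ★ **(M3, top-letter sum negative)** NO-DIP company at the MIDDLE coupling (`a_{j0} a_{j2} ≤ 0`, `0 < p`, `0 < s`), pole-free interval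
`[u,v] ⊂ (0,∞)` on which `A₂ = Σ_j a_{j2}x^p/g_j < 0`: the c-free Euler numerator `eulerNumerator d a 1` has AT MOST ONE zero in `[u,v]`.
[this file's theorem] -/
theorem eulerNumeratorMiddle_roots_Icc_le_one_of_letterSumTwo_neg {m : ℕ} (d0 p s : ℕ) (hp : 0 < p) (hs : 0 < s)
    (a : Fin m → Fin 3 → ℝ) (hnd : ∀ j, a j 0 * a j 2 ≤ 0) {u v : ℝ} (hu : 0 < u)
    (hg : ∀ x ∈ Set.Icc u v, ∀ j, a j 0 + a j 1 * x ^ p + a j 2 * x ^ (p + s) ≠ 0)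
    (hA : ∀ x ∈ Set.Icc u v, ∑ j, a j 2 * x ^ p / (a j 0 + a j 1 * x ^ p + a j 2 * x ^ (p + s)) < 0) :
    ((∑ j, (∑ l, C (a j l * (((![d0, d0 + p, d0 + p + s] : Fin 3 → ℕ) l : ℝ) - (![d0, d0 + p, d0 + p + s] : Fin 3 → ℕ) 1)) *
        X ^ ((![d0, d0 + p, d0 + p + s] : Fin 3 → ℕ) l)) *
      ∏ i ∈ Finset.univ.erase j, (∑ l, C (a i l) * X ^ ((![d0, d0 + p, d0 + p + s] : Fin 3 → ℕ) l)) : ℝ[X]).roots.toFinset.filter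
        (fun t => u ≤ t ∧ t ≤ v)).card ≤ 1 := by
  classical
  set A₀ : ℝ → ℝ := fun y => ∑ j, a j 0 * y ^ p / (a j 0 + a j 1 * y ^ p + a j 2 * y ^ (p + s)) with hA₀
  set A₂ : ℝ → ℝ := fun y => ∑ j, a j 2 * y ^ p / (a j 0 + a j 1 * y ^ p + a j 2 * y ^ (p + s)) with hA₂
  obtain ⟨hA₀mono, hA₂anti⟩ := letterSumsMiddle_monotone p s hp a hnd hu hg
  -- `Ξ(x) = −p A₀(x) + s x^{p+s} A₂(x)` is strictly antitone on `[u,v]`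
  have hΞ : ∀ x ∈ Set.Icc u v, ∀ y ∈ Set.Icc u v, x < y →
      -(p : ℝ) * A₀ y + (s : ℝ) * y ^ (p + s) * A₂ y < -(p : ℝ) * A₀ x + (s : ℝ) * x ^ (p + s) * A₂ x := by
    intro x hx y hy hxy
    have hx0 : 0 < x := hu.trans_le hx.1
    have h1 : A₀ x ≤ A₀ y := hA₀mono hx hy hxy.le
    have h2 : A₂ y ≤ A₂ x := hA₂anti hx hy hxy.le
    have hpow : x ^ (p + s) < y ^ (p + s) := pow_lt_pow_left₀ hxy hx0.le (by omega)
    have hAx : A₂ x < 0 := hA x hx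
    have hpR : 0 ≤ (p : ℝ) := Nat.cast_nonneg _
    have hsR : 0 < (s : ℝ) := by exact_mod_cast hs
    have step1 : (s : ℝ) * y ^ (p + s) * A₂ y ≤ (s : ℝ) * y ^ (p + s) * A₂ x :=
      mul_le_mul_of_nonneg_left h2 (mul_nonneg hsR.le (pow_nonneg (hx0.trans hxy).le _))
    have step2 : (s : ℝ) * y ^ (p + s) * A₂ x < (s : ℝ) * x ^ (p + s) * A₂ x := by
      have := mul_lt_mul_of_neg_right hpow hAx
      nlinarith
    have step3 : -(p : ℝ) * A₀ y ≤ -(p : ℝ) * A₀ x := by nlinarith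
    linarith
  have hroot : ∀ t, t ∈ ((∑ j, (∑ l, C (a j l * (((![d0, d0 + p, d0 + p + s] : Fin 3 → ℕ) l : ℝ)
        - (![d0, d0 + p, d0 + p + s] : Fin 3 → ℕ) 1)) * X ^ ((![d0, d0 + p, d0 + p + s] : Fin 3 → ℕ) l)) *
      ∏ i ∈ Finset.univ.erase j, (∑ l, C (a i l) * X ^ ((![d0, d0 + p, d0 + p + s] : Fin 3 → ℕ) l)) : ℝ[X]).roots.toFinset.filter
        (fun t => u ≤ t ∧ t ≤ v)) → -(p : ℝ) * A₀ t + (s : ℝ) * t ^ (p + s) * A₂ t = 0 := by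
    intro t ht
    rw [Finset.mem_filter, Multiset.mem_toFinset] at ht
    obtain ⟨hrt, htI⟩ := ht
    have htI' : t ∈ Set.Icc u v := htI
    have ht0 : 0 < t := hu.trans_le htI.1
    have hev := (mem_roots (ne_zero_of_mem_roots hrt)).mp hrt
    exact (eulerNumeratorMiddle_eval_eq_zero_iff d0 p s a ht0 (hg t htI')).mp hev
  rw [Finset.card_le_one]
  intro t₁ ht₁ t₂ ht₂
  have h1 := hroot t₁ ht₁
  have h2 := hroot t₂ ht₂
  have ht₁I : t₁ ∈ Set.Icc u v := (Finset.mem_filter.mp ht₁).2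
  have ht₂I : t₂ ∈ Set.Icc u v := (Finset.mem_filter.mp ht₂).2
  by_contra hne
  rcases lt_or_gt_of_ne hne with h | h
  · have := hΞ t₁ ht₁I t₂ ht₂I h; linarith
  · have := hΞ t₂ ht₂I t₁ ht₁I h; linarith

/-- ★ **(M3, bottom-letter sum negative)** NO-DIP company at the MIDDLE coupling, pole-free interval `[u,v] ⊂ (0,∞)` on which
`A₀ = Σ_j a_{j0}x^p/g_j < 0`: the c-free Euler numerator `eulerNumerator d a 1` has AT MOST ONE zero in `[u,v]`
(`−p x^{−(p+s)} A₀ + s A₂` strictly antitone). [this file's theorem] -/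
theorem eulerNumeratorMiddle_roots_Icc_le_one_of_letterSumZero_neg {m : ℕ} (d0 p s : ℕ) (hp : 0 < p) (hs : 0 < s)
    (a : Fin m → Fin 3 → ℝ) (hnd : ∀ j, a j 0 * a j 2 ≤ 0) {u v : ℝ} (hu : 0 < u)
    (hg : ∀ x ∈ Set.Icc u v, ∀ j, a j 0 + a j 1 * x ^ p + a j 2 * x ^ (p + s) ≠ 0)
    (hA : ∀ x ∈ Set.Icc u v, ∑ j, a j 0 * x ^ p / (a j 0 + a j 1 * x ^ p + a j 2 * x ^ (p + s)) < 0) :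
    ((∑ j, (∑ l, C (a j l * (((![d0, d0 + p, d0 + p + s] : Fin 3 → ℕ) l : ℝ) - (![d0, d0 + p, d0 + p + s] : Fin 3 → ℕ) 1)) *
        X ^ ((![d0, d0 + p, d0 + p + s] : Fin 3 → ℕ) l)) *
      ∏ i ∈ Finset.univ.erase j, (∑ l, C (a i l) * X ^ ((![d0, d0 + p, d0 + p + s] : Fin 3 → ℕ) l)) : ℝ[X]).roots.toFinset.filter
        (fun t => u ≤ t ∧ t ≤ v)).card ≤ 1 := by
  classical
  set A₀ : ℝ → ℝ := fun y => ∑ j, a j 0 * y ^ p / (a j 0 + a j 1 * y ^ p + a j 2 * y ^ (p + s)) with hA₀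
  set A₂ : ℝ → ℝ := fun y => ∑ j, a j 2 * y ^ p / (a j 0 + a j 1 * y ^ p + a j 2 * y ^ (p + s)) with hA₂
  obtain ⟨hA₀mono, hA₂anti⟩ := letterSumsMiddle_monotone p s hp a hnd hu hg
  -- `Ξ(x) = −p x^{−(p+s)} A₀(x) + s A₂(x)` is strictly antitone on `[u,v]`
  have hΞ : ∀ x ∈ Set.Icc u v, ∀ y ∈ Set.Icc u v, x < y →
      -(p : ℝ) * (y ^ (p + s))⁻¹ * A₀ y + (s : ℝ) * A₂ y < -(p : ℝ) * (x ^ (p + s))⁻¹ * A₀ x + (s : ℝ) * A₂ x := by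
    intro x hx y hy hxy
    have hx0 : 0 < x := hu.trans_le hx.1
    have h1 : A₀ x ≤ A₀ y := hA₀mono hx hy hxy.le
    have h2 : A₂ y ≤ A₂ x := hA₂anti hx hy hxy.le
    have hpow : x ^ (p + s) < y ^ (p + s) := pow_lt_pow_left₀ hxy hx0.le (by omega)
    have hxp : 0 < x ^ (p + s) := pow_pos hx0 _
    have hyp : 0 < y ^ (p + s) := pow_pos (hx0.trans hxy) _
    have hinv : (y ^ (p + s))⁻¹ < (x ^ (p + s))⁻¹ := inv_strictAnti₀ hxp hpow
    have hAx : A₀ x < 0 := hA x hx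
    have hAy : A₀ y < 0 := hA y hy
    have hpR : 0 < (p : ℝ) := by exact_mod_cast hp
    have hsR : 0 ≤ (s : ℝ) := Nat.cast_nonneg _
    -- `−p y⁻ᵏ A₀(y) = p y⁻ᵏ |A₀(y)|`: smaller `y⁻ᵏ` and smaller `|A₀(y)|`
    have step1 : -(p : ℝ) * (y ^ (p + s))⁻¹ * A₀ y ≤ -(p : ℝ) * (x ^ (p + s))⁻¹ * A₀ y := by
      have : 0 ≤ -A₀ y := by linarith
      nlinarith [mul_nonneg (mul_nonneg hpR.le (sub_nonneg.mpr hinv.le)) this]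
    have step2 : -(p : ℝ) * (x ^ (p + s))⁻¹ * A₀ y < -(p : ℝ) * (x ^ (p + s))⁻¹ * A₀ x ∨
        (-(p : ℝ) * (x ^ (p + s))⁻¹ * A₀ y ≤ -(p : ℝ) * (x ^ (p + s))⁻¹ * A₀ x) := by
      right
      have hc : 0 ≤ (p : ℝ) * (x ^ (p + s))⁻¹ := mul_nonneg hpR.le (inv_nonneg.mpr hxp.le)
      nlinarith [mul_le_mul_of_nonneg_left h1 hc]
    have step3 : (s : ℝ) * A₂ y ≤ (s : ℝ) * A₂ x := mul_le_mul_of_nonneg_left h2 hsR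
    -- strictness from the strictly smaller inverse power at the NEGATIVE value `A₀ y`
    have strict : -(p : ℝ) * (y ^ (p + s))⁻¹ * A₀ y < -(p : ℝ) * (x ^ (p + s))⁻¹ * A₀ y := by
      have hneg : 0 < -A₀ y := by linarith
      have := mul_lt_mul_of_pos_right hinv (mul_pos hpR hneg)
      nlinarith
    rcases step2 with h | h <;> linarith
  have hroot : ∀ t, t ∈ ((∑ j, (∑ l, C (a j l * (((![d0, d0 + p, d0 + p + s] : Fin 3 → ℕ) l : ℝ)
        - (![d0, d0 + p, d0 + p + s] : Fin 3 → ℕ) 1)) * X ^ ((![d0, d0 + p, d0 + p + s] : Fin 3 → ℕ) l)) *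
      ∏ i ∈ Finset.univ.erase j, (∑ l, C (a i l) * X ^ ((![d0, d0 + p, d0 + p + s] : Fin 3 → ℕ) l)) : ℝ[X]).roots.toFinset.filter
        (fun t => u ≤ t ∧ t ≤ v)) → -(p : ℝ) * (t ^ (p + s))⁻¹ * A₀ t + (s : ℝ) * A₂ t = 0 := by
    intro t ht
    rw [Finset.mem_filter, Multiset.mem_toFinset] at ht
    obtain ⟨hrt, htI⟩ := ht
    have htI' : t ∈ Set.Icc u v := htI
    have ht0 : 0 < t := hu.trans_le htI.1
    have hev := (mem_roots (ne_zero_of_mem_roots hrt)).mp hrt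
    have hz := (eulerNumeratorMiddle_eval_eq_zero_iff d0 p s a ht0 (hg t htI')).mp hev
    have htp : t ^ (p + s) ≠ 0 := pow_ne_zero _ ht0.ne'
    have : -(p : ℝ) * (t ^ (p + s))⁻¹ * A₀ t + (s : ℝ) * A₂ t
        = (-(p : ℝ) * A₀ t + (s : ℝ) * t ^ (p + s) * A₂ t) / t ^ (p + s) := by
      field_simp
    rw [this, hz, zero_div]
  rw [Finset.card_le_one]
  intro t₁ ht₁ t₂ ht₂
  have h1 := hroot t₁ ht₁
  have h2 := hroot t₂ ht₂
  have ht₁I : t₁ ∈ Set.Icc u v := (Finset.mem_filter.mp ht₁).2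
  have ht₂I : t₂ ∈ Set.Icc u v := (Finset.mem_filter.mp ht₂).2
  by_contra hne
  rcases lt_or_gt_of_ne hne with h | h
  · have := hΞ t₁ ht₁I t₂ ht₂I h; linarith
  · have := hΞ t₂ ht₂I t₁ ht₁I h; linarith

end ProductPlusOne

end Summit.ValiantsHypothesis.ValiantsHypothesis.Theorems.LacunarySymmetroidMatrixDescartes
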